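import Summits.BirchSwinnertonDyer.BirchSwinnertonDyer.Theorems.EdixhovenFibreFiveSevenStarredOptimalManinUnitFiveSevenAssemblyAdapters
import HarnessLib

/-!
# F″ programme, the ASSEMBLY one step before P1: Kato's Néron-twisted integrality F″ ⟸ [level = conductor] + H″,
# H″ = «the P1 draft's SL₂(ℤ)-type Néron value law at Kato's member WITH the semi-local integrality of the values
# attached» (= P1 ∘ P4-coh ∘ receptacle, i.e. everything the dual-exponential currency is needed for, packaged in the
# elementary currency `H¹(ℚ(μ_m), T_pW′) → ℚ_p ⊗ ℚ(ζ_m) ≃ ∏_{w∣p} ℚ(ζ_m)_w`)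
# (route `EdixhovenFibreFiveSeven`, crux K★ `StarredOptimalManinUnitFiveSeven`, stmt-BirchSwinnertonDyer-22226, line
# `kato-lever`; `--supports` 22226, helper)

Cell `pub/bsd-wall`, seat `bsd-line-edix-p4` g3. TOOL theorem only (no definition, no named fact, no `sorry`; H″ and
Carayol's level fact are DISPLAYED HYPOTHESES); nothing is closed or booked; BSD is not proved by any of this.

WHY. After the assembly socket (`KatoAssemblySocket.kato_neron_five_le_of_memberValueLaw`, p600780) the chain reads
F″ ⟸ hlev + [P1 ∘ P4-coh ∘ receptacle ∘ P4-core ⟹ H]. The P1 DRAFT (seat manin-p1 g8,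
`Cruxes/ManinFrameResidueProper/Lines/P1_DRAFT_KatoSL2NeronValues_manin_p1_g8.lean`, binder list frozen 03:50Z) fixes
the shape of everything EXCEPT the semi-local integrality «`∀ y, ∀ w ∣ p, Ψ (Λ y) w ∈ 𝒪_w`», which is P4-coh's output
(seat edix-p3 g4) from P1's (PIN)/(RES)/(DEF) clauses, the cite (S5b-tower) and the landed receptacle. THIS FILE takes
as hypothesis H″ := «P1's member / Manin-symbol coordinates / level data `(ι, Λ)` / classes / value law» VERBATIM in
the draft's currency, with (PIN)/(RES)/(DEF) REPLACED by a semi-local isomorphism `Ψ` (with its pure-tensor formula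
`hΨ`, as in `Kato2004.DefinedExpStarBody` and `AdelicBaseChange.exists_padicTensorAlgEquiv`) and the integrality clause
(guarded by exactly the receptacle's hypotheses: `5 ≤ p`, `W′` additive at `p`, `gcd(m, pN) = 1`, F″'s
Kosters–Pannekoek clause at `W′`) — and proves **F″ ⟸ [level = conductor] + H″** by pure instantiation: P4-core
(`SemiLocalDescent.exists_not_dvd_isIntegral_charSum_of_forall_semilocal_mem`, p598912) turns the integrality clause and
the rationality `Λ z = 1 ⊗ x` into «`charSum m ι χ̄ x` is `p`-integral», the adapters (p601597) convert the draft's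
guards/parity/factor, and the socket p600780 does the rest. So the ENTIRE remaining debt of the crux's stub F″ is:
P1 (cite-only, to be proposed) ∧ (S5b) ∧ P4-coh ⟹ H″ — one theorem in the dual-exponential currency, no value-law,
unit, Birch, Euler-factor, isogeny or level bookkeeping left in it.

WHAT IS PROVED.
* ★ `kato_neron_five_le_of_integralSL2NeronValues` — **F″ ⟸ [level = conductor] + H″** (H″ displayed in the
  statement; its value-law block is the P1 draft's, byte for byte up to the bound names).

References: [Kato2004Asterisque] K. Kato, Astérisque 295 (2004), (8.1.3) p. 180, §8.3 p. 181, Thm. 9.7 p. 189,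
Thm. 6.6 (1) p. 163, Thm. 13.6 p. 227; [CasselsFrohlichANT1967] Ch. II §10 (10.2) (the semi-local algebra);
[KimNakamura2020] Cor. 2.4; [Carayol1986]; programme `Cruxes/StarredOptimalManinUnitFiveSeven/Lines/kato-lever-F2-programme.md`
§4/§8, `…/Lines/kato-lever-assembly-socket.md`, `Cruxes/ManinFrameResidueProper/P4-ROADMAP-manin-p1-g8.md` §1–§3.
-/

set_option autoImplicit false
-- the Theorems namespace of a single-conjunct summit repeats the summit name by design (D-0017)
set_option linter.dupNamespace false

noncomputable section

open scoped MatrixGroups ModularForm Classical NumberField TensorProduct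
open Complex CongruenceSubgroup WeierstrassCurve IsDedekindDomain NumberField
open Literature.NumberTheory.GaloisRepresentations
open Literature.NumberTheory.EllipticCurves Literature.NumberTheory.EllipticCurves.ModularForms
open Literature.NumberTheory.EllipticCurves.Kato2004 Literature.NumberTheory.EllipticCurves.Kato2004.EulerSystemValues
open Summit.BirchSwinnertonDyer.BirchSwinnertonDyer.Theorems.SemiLocalDescent
open Summit.BirchSwinnertonDyer.BirchSwinnertonDyer.Theorems.KatoNeronIsogenyTransport

namespace Summit.BirchSwinnertonDyer.BirchSwinnertonDyer.Theorems.KatoAssemblySocket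

set_option backward.isDefEq.respectTransparency false in
/-- ★ **F″ ⟸ [level = conductor] + H″ (the P1 draft's SL₂(ℤ)-type Néron value law at Kato's member, with the
semi-local integrality of the values attached).** `hlev` is Carayol's `IsNewformOf.level_eq_conductorNorm` (over the
tree a consequence of modularity). H″ says: for every elliptic `W/ℚ` and prime `p` there is a globally minimal
`W′ ∼ W` (Kato's member, §8.3) such that — for the newform `f` of `W` — there are Manin-symbol coordinates
`n : SL₂(ℤ) → Bool → ℚ` with a `p`-adic unit of each sign for `p ≠ 2` (Thm. 13.6), and at every level `m` an
embedding `ι`, a `ℤ_p`-linear `Λ : H¹(ℚ(μ_m), T_pW′) → ℚ_p ⊗ ℚ(ζ_m)` and a semi-local isomorphism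
`Ψ : ℚ_p ⊗ ℚ(ζ_m) ≃ ∏_{w∣p} ℚ(ζ_m)_w` with the pure-tensor formula (Cassels–Fröhlich II (10.2)), such that
(INT) when `p ≥ 5`, `W′` is additive at `p`, `gcd(m, pN) = 1` and F″'s Kosters–Pannekoek clause holds at `W′`,
every value `Λ y` has all its `w`-components in `𝒪_w` (P1's Néron pin + Kim–Nakamura's receptacle, = P4-coh), and
(VAL) for all `c ≡ d ≡ 1 (mod N)` with `gcd(cd, 6pm) = 1` and every `ξ ∈ SL₂(ℤ)` there are a class `z`
((8.1.3)) and a RATIONAL `x` with `Λ z = 1 ⊗ x` (Thm. 9.7) satisfying, for every `χ` mod `m` and every entire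
continuation `Lχ` of the `(m·pN)`-depleted series, `Σ_b χ(b)ι(σ_b x) = (c² − cχ(c))(d² − dχ(d)⁻¹)·(n ξ ±)·Lχ(1)/Ω^±(W′)`
(Thm. 6.6 (1), case `ξ ∈ SL₂(ℤ)`; `Ω⁺ = Ω(W′)`, `Ω⁻ = i·|Ω⁻(W′)|`). Conclusion: F″.
[cite: Kato2004Asterisque, (8.1.3) (p. 180), §8.3 (p. 181), Thm. 9.7 (p. 189), Thm. 6.6 (1) (p. 163), Thm. 13.6 (p. 227)]
[cite: CasselsFrohlichANT1967, Ch. II §10 Theorem (10.2)] [cite: KimNakamura2020, Cor. 2.4] [cite: Carayol1986] -/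
theorem kato_neron_five_le_of_integralSL2NeronValues
    (hlev : ∀ {N : ℕ} [NeZero N], IsNewformOf.level_eq_conductorNorm (N := N))
    (H : ∀ (W : WeierstrassCurve ℚ) [W.IsElliptic] (p : ℕ) [Fact p.Prime],
      ∃ (W' : WeierstrassCurve ℚ) (_ : W'.IsElliptic) (_ : W'.IsGloballyMinimal), IsIsogenous W W' ∧
      ∀ [ContinuousSMul ℤ_[p] (W'.tateModule p)] [Module.Free ℤ_[p] (W'.tateModule p)]
        [Module.Finite ℤ_[p] (W'.tateModule p)],
      ∀ {N : ℕ} [NeZero N] (f : CuspForm (Gamma0 N) 2), IsNewformOf W f →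
      ∃ n : SL(2, ℤ) → Bool → ℚ,
        (p ≠ 2 → ∀ b : Bool, ∃ ξ : SL(2, ℤ), n ξ b ≠ 0 ∧ padicValRat p (n ξ b) = 0) ∧
        ∀ (m : ℕ) [NeZero m],
          ∃ (ι : CyclotomicField m ℚ →+* ℂ)
            (Λ : H1 (tateRep W' p) (rootsOfUnityFixer ℚ m) →ₗ[ℤ_[p]] ℚ_[p] ⊗[ℚ] CyclotomicField m ℚ)
            (Ψ : ℚ_[p] ⊗[ℚ] CyclotomicField m ℚ ≃ₐ[ℚ]
              (Π w : ((Rat.HeightOneSpectrum.primesEquiv (R := 𝓞 ℚ)).symm ⟨p, Fact.out⟩).Extension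
                (𝓞 (CyclotomicField m ℚ)), w.1.adicCompletion (CyclotomicField m ℚ))),
            (∀ (s : ℚ_[p]) (x : CyclotomicField m ℚ)
              (w : ((Rat.HeightOneSpectrum.primesEquiv (R := 𝓞 ℚ)).symm ⟨p, Fact.out⟩).Extension
                (𝓞 (CyclotomicField m ℚ))),
              Ψ (s ⊗ₜ[ℚ] x) w =
                algebraMap (CyclotomicField m ℚ) (w.1.adicCompletion (CyclotomicField m ℚ)) x *
                algebraMap (((Rat.HeightOneSpectrum.primesEquiv (R := 𝓞 ℚ)).symm ⟨p, Fact.out⟩).adicCompletion ℚ)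
                  (w.1.adicCompletion (CyclotomicField m ℚ)) ((Padic.adicCompletionEquiv (𝓞 ℚ) ⟨p, Fact.out⟩) s)) ∧
            -- (INT) semi-local integrality of every value (P1's Néron pin + the receptacle = P4-coh)
            (5 ≤ p → ¬ W'.HasGoodReductionAtPrime p → ¬ W'.HasMultiplicativeReductionAtPrime p →
              m.Coprime (p * N) →
              (7 < p ∨ (Nat.Coprime (orderOf (p : ZMod m)) (p - 1) ∧
                ∀ P : (W'.baseChange ℚ_[p]).toAffine.Point, p • P = 0 → P = 0)) →
              ∀ (y : H1 (tateRep W' p) (rootsOfUnityFixer ℚ m))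
                (w : ((Rat.HeightOneSpectrum.primesEquiv (R := 𝓞 ℚ)).symm ⟨p, Fact.out⟩).Extension
                  (𝓞 (CyclotomicField m ℚ))),
                Ψ (Λ y) w ∈ w.1.adicCompletionIntegers (CyclotomicField m ℚ)) ∧
            -- (VAL) classes (8.1.3), rationality (Thm. 9.7), value law (Thm. 6.6 (1), SL₂(ℤ) case) — P1 draft verbatim
            ∀ (c d : ℤ) (ξ : SL(2, ℤ)), c ≡ 1 [ZMOD (N : ℤ)] → d ≡ 1 [ZMOD (N : ℤ)] →
              Int.gcd (c * d) (6 * p * m) = 1 →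
              ∃ (z : H1 (tateRep W' p) (rootsOfUnityFixer ℚ m)) (x : CyclotomicField m ℚ),
                Λ z = (1 : ℚ_[p]) ⊗ₜ[ℚ] x ∧
                ∀ (χ : DirichletCharacter ℂ m) (Lχ : ℂ → ℂ), IsDepletedTwistedL f m (p * N) χ Lχ →
                  (χ (-1) = 1 →
                    charSum m ι χ x =
                      (((c : ℂ) ^ 2 - (c : ℂ) * χ (c : ZMod m)) * ((d : ℂ) ^ 2 - (d : ℂ) * (χ (d : ZMod m))⁻¹)) *
                        ((n ξ true : ℚ) : ℂ) * (Lχ 1 / (W'.realPeriodRat : ℂ))) ∧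
                  (χ (-1) = -1 →
                    charSum m ι χ x =
                      (((c : ℂ) ^ 2 - (c : ℂ) * χ (c : ZMod m)) * ((d : ℂ) ^ 2 - (d : ℂ) * (χ (d : ZMod m))⁻¹)) *
                        ((n ξ false : ℚ) : ℂ) * (Lχ 1 / (Complex.I * (W'.imaginaryPeriodRat : ℂ))))) :
    kato_neron_isIntegral_twistedSymbolSum_of_additive_five_le := by
  refine kato_neron_five_le_of_memberValueLaw hlev
    fun V _ _ N _ f hf p _ hp5 hgood hmult hirr m _ hm htors χ hχ hχ1 hord ↦ ?_
  obtain ⟨W', hW'E, hW'M, hiso, hW'⟩ := H V p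
  letI : ContinuousSMul ℤ_[p] (W'.tateModule p) := TateModule.continuousSMul_padicInt
  haveI : Module.Free ℤ_[p] (W'.tateModule p) := W'.module_free_tateModule_holds p
  haveI : Module.Finite ℤ_[p] (W'.tateModule p) := W'.module_finite_tateModule_holds p
  obtain ⟨n, hn, hlevel⟩ := hW' f hf
  obtain ⟨ι, Λ, Ψ, hΨ, hint, hval⟩ := hlevel m
  refine ⟨W', hW'E, hW'M, hiso, fun _ hgoodW hmultW _ htorsW L hL c d hc hd ↦ ?_⟩
  obtain ⟨-, hcN, -, -, hccop, -, -⟩ := hc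
  obtain ⟨-, hdN, -, -, hdcop, -, -⟩ := hd
  have hint' := hint hp5 hgoodW hmultW hm htorsW
  have hp2 : p ≠ 2 := by omega
  -- Kato's guards for `(c, d)` in the draft's `ℤ`-currency
  have hcZ : (c : ℤ) ≡ 1 [ZMOD (N : ℤ)] := intModEq_one_of_natModEq_one hcN
  have hdZ : (d : ℤ) ≡ 1 [ZMOD (N : ℤ)] := intModEq_one_of_natModEq_one hdN
  have hgcd : Int.gcd ((c : ℤ) * (d : ℤ)) (6 * (p : ℤ) * (m : ℤ)) = 1 := int_gcd_mul_eq_one_of_coprime hccop hdcop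
  -- the parity of `χ` decides the sign `b` at which the Manin-symbol coordinate is taken
  by_cases hev : χ.Even
  · obtain ⟨ξ, hnξ0, hnξv⟩ := hn hp2 true
    obtain ⟨z, x, hΛz, hlaw⟩ := hval (c : ℤ) (d : ℤ) ξ hcZ hdZ hgcd
    obtain ⟨hlawE, -⟩ := hlaw χ⁻¹ L hL
    have hE : χ⁻¹ (-1) = 1 := (inv_apply_neg_one_eq_one_iff χ).2 hev
    have hlawE' := hlawE hE
    refine ⟨n ξ true, charSum m ι χ⁻¹ x, χ⁻¹ (c : ZMod m), χ (d : ZMod m),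
      not_dvd_num_of_padicValRat_eq_zero hnξ0 hnξv,
      exists_not_dvd_isIntegral_charSum_of_forall_semilocal_mem m p Ψ hΨ x (Λ z) hΛz (hint' z) ι χ⁻¹,
      Or.inr rfl, Or.inl rfl, fun _ ↦ ?_, fun hod ↦ ?_⟩
    · rw [hlawE', katoFactor_inv_reading]
      push_cast
      ring
    · exfalso
      have h1 : χ (-1) = 1 := hev
      have h2 : χ (-1) = -1 := hod
      rw [h1] at h2
      norm_num at h2
  · obtain ⟨ξ, hnξ0, hnξv⟩ := hn hp2 false
    obtain ⟨z, x, hΛz, hlaw⟩ := hval (c : ℤ) (d : ℤ) ξ hcZ hdZ hgcd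
    obtain ⟨-, hlawO⟩ := hlaw χ⁻¹ L hL
    refine ⟨n ξ false, charSum m ι χ⁻¹ x, χ⁻¹ (c : ZMod m), χ (d : ZMod m),
      not_dvd_num_of_padicValRat_eq_zero hnξ0 hnξv,
      exists_not_dvd_isIntegral_charSum_of_forall_semilocal_mem m p Ψ hΨ x (Λ z) hΛz (hint' z) ι χ⁻¹,
      Or.inr rfl, Or.inl rfl, fun hev' ↦ absurd hev' hev, fun hod ↦ ?_⟩
    have hO : χ⁻¹ (-1) = -1 := (inv_apply_neg_one_eq_neg_one_iff χ).2 hod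
    rw [hlawO hO, katoFactor_inv_reading]
    push_cast
    ring

end Summit.BirchSwinnertonDyer.BirchSwinnertonDyer.Theorems.KatoAssemblySocket

end
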